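import Literature.NumberTheory.Transcendental.MultipleZetaDepthTwoProofs
import HarnessLib

/-!
# Multiple zeta values — proofs: Hoffman's relation and duality in weight `4`, `ζ(2,1,1) = ζ(4)`

Sibling proof file of `Literature.NumberTheory.Transcendental.MultipleZeta` (towards weight `4`
of Zagier's dimension conjecture), continuing `MultipleZetaDepthTwoProofs.lean`. It proves,
sorry-free and with no new definition or named fact, in the decreasing convention
`ζ(s₁,…,s_k) = ∑_{n₁ > ⋯ > n_k ≥ 1} ∏ nᵢ^{-sᵢ}` of `multipleZeta` (which is also Hoffman's
convention for his `A(i₁,…,i_k)`):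

* `multipleZeta_two_one_one_eq_add` — Hoffman's relation `ζ(2,1,1) = ζ(3,1) + ζ(2,2)`
  (Hoffman 1992, Theorem 5.1, applied to the sequence `(2,1)`:
  `A(3,1) + A(2,2) = A(2,1,1)`);
* `multipleZeta_two_one_one_eq_four` — the duality `ζ(2,1,1) = ζ(4)` (Hoffman 1992,
  Theorem 4.4 with `h = 1`, `k = 3`; §5: "for `n = 4` we have `A(2,1,1) = A(4)` and
  `A(3,1) + A(2,2) = A(4)`"; Chmutov–Duzhin–Mostovoy 2012, §10.2.6, duality table:
  `ζ(1,1,2) = ζ(4)` in the increasing convention), from Hoffman's relation and Euler's sum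
  formula `ζ(3,1) + ζ(2,2) = ζ(4)` (`multipleZeta_three_one_add_two_two`);
* `multipleZeta_two_one_one` — `ζ(2,1,1) = π⁴/90` (Chmutov–Duzhin–Mostovoy 2012, §10.2.6: "the
  values of all MZVs of weight 4: `ζ(2,2) = π⁴/120`, `ζ(1,3) = π⁴/360`,
  `ζ(1,1,2) = ζ(4) = π⁴/90`").

## Method

As in `MultipleZetaDepthTwoProofs.lean`, all series are handled in `ℝ≥0∞` in product
coordinates (`ofReal_multipleZeta_depth_three`:
`ENNReal.ofReal (ζ(a,b,c)) = ∑_{n,k,j ≥ 0} (n+k+j+3)^{-a} (n+k+2)^{-b} (n+1)^{-c}`). Hoffman's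
relation is obtained by evaluating the auxiliary triple sum
`V = ∑_{a,b,c ≥ 1} 1/(a b c (a+b+c))` in two ways ("a standard partial-fractions identity",
Hoffman 1992, proof of Theorem 5.1; Borwein–Bradley 2006, §2). Repeated use of
`1/(xy) = (1/x + 1/y)/(x+y)` and of the symmetries of `ℕ³` gives `V = 6 ζ(2,1,1)`
(`tsum_vAux_eq_six_mul`). Telescoping the innermost variable instead
(`∑_c 1/(c(c+M)) = H_M / M`, `tsum_vAux_inner`) gives `V = 2 ∑_{m > a ≥ 1} H_m/(a m²)`
(`tsum_vAux_eq_uAux_add`), and splitting `H_m = ∑_{i ≤ m} 1/i` according to the position of `i`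
relative to `a < m` gives `∑_{m>a} H_m/(a m²) = 2 ζ(2,1,1) + ζ(2,2) + ζ(3,1)` (`tsum_uAux_eq`).
Comparing, `6 ζ(2,1,1) = 4 ζ(2,1,1) + 2 ζ(2,2) + 2 ζ(3,1)`, and the finite quantity `4 ζ(2,1,1)`
cancels.

## References

* M. E. Hoffman, *Multiple harmonic series*, Pacific J. Math. 152 (1992), 275–290: Theorem 4.4
  (duality for `(h+1,1,…,1)`), Theorem 5.1 (the relation), §5 p. 288 (weight `4`). [Hoffman1992]
* S. Chmutov, S. Duzhin, J. Mostovoy, *Introduction to Vassiliev Knot Invariants*, CUP (2012),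
  §10.2.6 (duality table; all MZVs of weight `4`). [ChmutovDuzhinMostovoy2012]
* J. M. Borwein, D. M. Bradley, *Thirty-two Goldbach variations*, Int. J. Number Theory 2 (2006),
  65–103, §2 (telescoping and partial fractions). [BorweinBradley2006]
-/

noncomputable section

open scoped BigOperators ENNReal
open Filter _root_.Topology

namespace Literature.NumberTheory.Transcendental

/-! ### Depth three in product coordinates -/

/-- An index `(a, b, c)` with `a ≥ 2`, `b, c ≥ 1` is admissible. [folklore] -/
theorem MZV.isAdmissible_triple {a b c : ℕ} (ha : 2 ≤ a) (hb : 1 ≤ b) (hc : 1 ≤ c) :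
    MZV.IsAdmissible [a, b, c] :=
  ⟨fun i hi => by
    simp only [List.mem_cons, List.not_mem_nil, or_false] at hi
    rcases hi with rfl | rfl | rfl <;> omega,
  fun _ => by simpa using ha⟩

/-- The general term of a triple zeta value: `mzvTerm [a, b, c] n = (n₀^a)⁻¹ (n₁^b)⁻¹ (n₂^c)⁻¹`.
[folklore] -/
theorem mzvTerm_triple (a b c : ℕ) (n : Fin [a, b, c].length → ℕ) :
    mzvTerm [a, b, c] n = ((n 0 : ℝ) ^ a)⁻¹ * ((n 1 : ℝ) ^ b)⁻¹ * ((n 2 : ℝ) ^ c)⁻¹ := by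
  unfold mzvTerm
  simp only [List.length_cons, List.length_nil, Nat.reduceAdd, Fin.prod_univ_succ,
    Fin.isValue, Fin.prod_univ_zero, mul_one]
  simp
  ring

/-- Depth three in product coordinates: for an admissible `(a, b, c)`,
`ENNReal.ofReal (ζ(a,b,c)) = ∑_{n,k,j ≥ 0} (n+k+j+3)^{-a} (n+k+2)^{-b} (n+1)^{-c}`
(`n₁ = n+k+j+3 > n₂ = n+k+2 > n₃ = n+1 ≥ 1`). [folklore] -/
theorem ofReal_multipleZeta_depth_three {a b c : ℕ} (hs : MZV.IsAdmissible [a, b, c]) :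
    ENNReal.ofReal (multipleZeta [a, b, c]) =
      ∑' p : ℕ × ℕ × ℕ, ENNReal.ofReal (1 / (((p.1 : ℝ) + p.2.1 + p.2.2 + 3) ^ a *
        ((p.1 : ℝ) + p.2.1 + 2) ^ b * ((p.1 : ℝ) + 1) ^ c)) := by
  let e : ℕ × ℕ × ℕ ≃ mzvIndexSet 3 :=
    { toFun := fun p => ⟨![p.1 + p.2.1 + p.2.2 + 3, p.1 + p.2.1 + 2, p.1 + 1],
        Fin.strictAnti_iff_succ_lt.mpr fun i => by
          fin_cases i <;> simp,
        fun i => by fin_cases i <;> simp⟩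
      invFun := fun n => (n.1 2 - 1, n.1 1 - n.1 2 - 1, n.1 0 - n.1 1 - 1)
      left_inv := fun p => by
        refine Prod.ext ?_ (Prod.ext ?_ ?_)
        · simp
        · simp
          omega
        · simp
          omega
      right_inv := fun n => by
        obtain ⟨v, hv, hpos⟩ := n
        have h10 : v 1 < v 0 := hv (show (0 : Fin 3) < 1 by decide)
        have h21 : v 2 < v 1 := hv (show (1 : Fin 3) < 2 by decide)
        have h2 : 0 < v 2 := hpos 2
        refine Subtype.ext (funext fun i => ?_)
        fin_cases i
        · simp
          omega
        · simp
          omega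
        · simp
          omega }
  rw [ofReal_multipleZeta_eq_tsum hs e]
  refine tsum_congr fun p => ?_
  rw [mzvTerm_triple]
  congr 1
  simp only [e, Equiv.coe_fn_mk, Matrix.cons_val_zero, Matrix.cons_val_one, Matrix.cons_val]
  push_cast
  rw [one_div, mul_inv, mul_inv]

/-- `ENNReal.ofReal (ζ(2,1,1)) = ∑_{n,k,j ≥ 0} 1/((n+1)(n+k+2)(n+k+j+3)²)`. [folklore] -/
theorem ofReal_multipleZeta_two_one_one : ENNReal.ofReal (multipleZeta [2, 1, 1]) =
    ∑' p : ℕ × ℕ × ℕ, ENNReal.ofReal (1 / (((p.1 : ℝ) + 1) * ((p.1 : ℝ) + p.2.1 + 2) * ((p.1 : ℝ) + p.2.1 + p.2.2 + 3) ^ 2)) := by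
  rw [ofReal_multipleZeta_depth_three (MZV.isAdmissible_triple le_rfl le_rfl le_rfl)]
  refine tsum_congr fun p => ?_
  rw [pow_one, pow_one]
  congr 1
  ring

/-! ### First evaluation: `V = 6 ζ(2,1,1)` -/

/-- Partial fraction in the two free variables of smallest index:
`1/(abc(a+b+c)) = 1/(a(a+b)c(a+b+c)) + 1/(b(b+a)c(b+a+c))`. [folklore] -/
theorem vAux_eq_add (n k j : ℕ) :
    (1 / (((n : ℝ) + 1) * ((k : ℝ) + 1) * ((j : ℝ) + 1) * ((n : ℝ) + k + j + 3)) : ℝ) =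
      1 / (((n : ℝ) + 1) * ((n : ℝ) + k + 2) * ((j : ℝ) + 1) * ((n : ℝ) + k + j + 3)) +
        1 / (((k : ℝ) + 1) * ((k : ℝ) + n + 2) * ((j : ℝ) + 1) * ((k : ℝ) + n + j + 3)) := by
  field_simp
  ring

/-- Partial fraction `1/(a(a+b)c(a+b+c)) = 1/(a(a+b)(a+b+c)²) + 1/(ac(a+b+c)²)`. [folklore] -/
theorem wAux_eq_add (n k j : ℕ) :
    (1 / (((n : ℝ) + 1) * ((n : ℝ) + k + 2) * ((j : ℝ) + 1) * ((n : ℝ) + k + j + 3)) : ℝ) =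
      1 / (((n : ℝ) + 1) * ((n : ℝ) + k + 2) * ((n : ℝ) + k + j + 3) ^ 2) +
        1 / (((n : ℝ) + 1) * ((j : ℝ) + 1) * ((n : ℝ) + k + j + 3) ^ 2) := by
  field_simp
  ring

/-- Partial fraction `1/(ac N²) = 1/(a(a+c)N²) + 1/(c(c+a)N²)`, `N = a+b+c`. [folklore] -/
theorem xAux_eq_add (n k j : ℕ) :
    (1 / (((n : ℝ) + 1) * ((j : ℝ) + 1) * ((n : ℝ) + k + j + 3) ^ 2) : ℝ) =
      1 / (((n : ℝ) + 1) * ((n : ℝ) + j + 2) * ((n : ℝ) + j + k + 3) ^ 2) +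
        1 / (((j : ℝ) + 1) * ((j : ℝ) + n + 2) * ((j : ℝ) + n + k + 3) ^ 2) := by
  field_simp
  ring

/-- **`V = 6 ζ(2,1,1)`** in `ℝ≥0∞`: the triple sum `V = ∑_{a,b,c ≥ 1} 1/(abc(a+b+c))` equals six
times `Z₂₁₁ = ∑_{n,k,j} 1/((n+1)(n+k+2)(n+k+j+3)²) = ENNReal.ofReal (ζ(2,1,1))`, by the three
partial fractions above and the symmetries of `ℕ³` (Hoffman 1992, proof of Theorem 5.1: "a
standard partial-fractions identity"). [cite: Hoffman1992, Theorem 5.1 (proof)] -/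
theorem tsum_vAux_eq_six_mul :
    ∑' p : ℕ × ℕ × ℕ, ENNReal.ofReal (1 / (((p.1 : ℝ) + 1) * ((p.2.1 : ℝ) + 1) * ((p.2.2 : ℝ) + 1) * ((p.1 : ℝ) + p.2.1 + p.2.2 + 3))) =
      6 * ∑' p : ℕ × ℕ × ℕ, ENNReal.ofReal (1 / (((p.1 : ℝ) + 1) * ((p.1 : ℝ) + p.2.1 + 2) * ((p.1 : ℝ) + p.2.1 + p.2.2 + 3) ^ 2)) := by
  -- the symmetries of `ℕ³` used below
  let e12 : ℕ × ℕ × ℕ ≃ ℕ × ℕ × ℕ :=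
    { toFun := fun p => (p.2.1, p.1, p.2.2), invFun := fun p => (p.2.1, p.1, p.2.2),
      left_inv := fun _ => rfl, right_inv := fun _ => rfl }
  let e23 : ℕ × ℕ × ℕ ≃ ℕ × ℕ × ℕ :=
    { toFun := fun p => (p.1, p.2.2, p.2.1), invFun := fun p => (p.1, p.2.2, p.2.1),
      left_inv := fun _ => rfl, right_inv := fun _ => rfl }
  let e312 : ℕ × ℕ × ℕ ≃ ℕ × ℕ × ℕ :=
    { toFun := fun p => (p.2.2, p.1, p.2.1), invFun := fun p => (p.2.1, p.2.2, p.1),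
      left_inv := fun _ => rfl, right_inv := fun _ => rfl }
  -- (c) `X = Z + Z`
  have hX : ∑' p : ℕ × ℕ × ℕ, ENNReal.ofReal (1 / (((p.1 : ℝ) + 1) * ((p.2.2 : ℝ) + 1) * ((p.1 : ℝ) + p.2.1 + p.2.2 + 3) ^ 2)) =
      (∑' p : ℕ × ℕ × ℕ, ENNReal.ofReal (1 / (((p.1 : ℝ) + 1) * ((p.1 : ℝ) + p.2.1 + 2) * ((p.1 : ℝ) + p.2.1 + p.2.2 + 3) ^ 2))) +
        ∑' p : ℕ × ℕ × ℕ, ENNReal.ofReal (1 / (((p.1 : ℝ) + 1) * ((p.1 : ℝ) + p.2.1 + 2) * ((p.1 : ℝ) + p.2.1 + p.2.2 + 3) ^ 2)) := by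
    have ht : ∀ p : ℕ × ℕ × ℕ, ENNReal.ofReal (1 / (((p.1 : ℝ) + 1) * ((p.2.2 : ℝ) + 1) * ((p.1 : ℝ) + p.2.1 + p.2.2 + 3) ^ 2)) =
        ENNReal.ofReal (1 / (((p.1 : ℝ) + 1) * ((p.1 : ℝ) + p.2.2 + 2) * ((p.1 : ℝ) + p.2.2 + p.2.1 + 3) ^ 2)) +
          ENNReal.ofReal (1 / (((p.2.2 : ℝ) + 1) * ((p.2.2 : ℝ) + p.1 + 2) * ((p.2.2 : ℝ) + p.1 + p.2.1 + 3) ^ 2)) := fun p => by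
      rw [← ENNReal.ofReal_add (by positivity) (by positivity), xAux_eq_add]
    simp_rw [ht]
    rw [ENNReal.tsum_add]
    exact congrArg₂ (· + ·)
      (e23.tsum_eq fun q : ℕ × ℕ × ℕ => ENNReal.ofReal (1 / (((q.1 : ℝ) + 1) * ((q.1 : ℝ) + q.2.1 + 2) * ((q.1 : ℝ) + q.2.1 + q.2.2 + 3) ^ 2)))
      (e312.tsum_eq fun q : ℕ × ℕ × ℕ => ENNReal.ofReal (1 / (((q.1 : ℝ) + 1) * ((q.1 : ℝ) + q.2.1 + 2) * ((q.1 : ℝ) + q.2.1 + q.2.2 + 3) ^ 2)))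
  -- (b) `W = Z + X`
  have hW : ∑' p : ℕ × ℕ × ℕ, ENNReal.ofReal (1 / (((p.1 : ℝ) + 1) * ((p.1 : ℝ) + p.2.1 + 2) * ((p.2.2 : ℝ) + 1) * ((p.1 : ℝ) + p.2.1 + p.2.2 + 3))) =
      (∑' p : ℕ × ℕ × ℕ, ENNReal.ofReal (1 / (((p.1 : ℝ) + 1) * ((p.1 : ℝ) + p.2.1 + 2) * ((p.1 : ℝ) + p.2.1 + p.2.2 + 3) ^ 2))) +
        ∑' p : ℕ × ℕ × ℕ, ENNReal.ofReal (1 / (((p.1 : ℝ) + 1) * ((p.2.2 : ℝ) + 1) * ((p.1 : ℝ) + p.2.1 + p.2.2 + 3) ^ 2)) := by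
    have ht : ∀ p : ℕ × ℕ × ℕ, ENNReal.ofReal (1 / (((p.1 : ℝ) + 1) * ((p.1 : ℝ) + p.2.1 + 2) * ((p.2.2 : ℝ) + 1) * ((p.1 : ℝ) + p.2.1 + p.2.2 + 3))) =
        ENNReal.ofReal (1 / (((p.1 : ℝ) + 1) * ((p.1 : ℝ) + p.2.1 + 2) * ((p.1 : ℝ) + p.2.1 + p.2.2 + 3) ^ 2)) +
          ENNReal.ofReal (1 / (((p.1 : ℝ) + 1) * ((p.2.2 : ℝ) + 1) * ((p.1 : ℝ) + p.2.1 + p.2.2 + 3) ^ 2)) := fun p => by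
      rw [← ENNReal.ofReal_add (by positivity) (by positivity), wAux_eq_add]
    simp_rw [ht]
    exact ENNReal.tsum_add
  -- (a) `V = W + W`
  have hV : ∑' p : ℕ × ℕ × ℕ, ENNReal.ofReal (1 / (((p.1 : ℝ) + 1) * ((p.2.1 : ℝ) + 1) * ((p.2.2 : ℝ) + 1) * ((p.1 : ℝ) + p.2.1 + p.2.2 + 3))) =
      (∑' p : ℕ × ℕ × ℕ, ENNReal.ofReal (1 / (((p.1 : ℝ) + 1) * ((p.1 : ℝ) + p.2.1 + 2) * ((p.2.2 : ℝ) + 1) * ((p.1 : ℝ) + p.2.1 + p.2.2 + 3)))) +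
        ∑' p : ℕ × ℕ × ℕ, ENNReal.ofReal (1 / (((p.1 : ℝ) + 1) * ((p.1 : ℝ) + p.2.1 + 2) * ((p.2.2 : ℝ) + 1) * ((p.1 : ℝ) + p.2.1 + p.2.2 + 3))) := by
    have ht : ∀ p : ℕ × ℕ × ℕ, ENNReal.ofReal (1 / (((p.1 : ℝ) + 1) * ((p.2.1 : ℝ) + 1) * ((p.2.2 : ℝ) + 1) * ((p.1 : ℝ) + p.2.1 + p.2.2 + 3))) =
        ENNReal.ofReal (1 / (((p.1 : ℝ) + 1) * ((p.1 : ℝ) + p.2.1 + 2) * ((p.2.2 : ℝ) + 1) * ((p.1 : ℝ) + p.2.1 + p.2.2 + 3))) +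
          ENNReal.ofReal (1 / (((p.2.1 : ℝ) + 1) * ((p.2.1 : ℝ) + p.1 + 2) * ((p.2.2 : ℝ) + 1) * ((p.2.1 : ℝ) + p.1 + p.2.2 + 3))) := fun p => by
      rw [← ENNReal.ofReal_add (by positivity) (by positivity), vAux_eq_add]
    simp_rw [ht]
    rw [ENNReal.tsum_add]
    exact congrArg₂ (· + ·) rfl
      (e12.tsum_eq fun q : ℕ × ℕ × ℕ => ENNReal.ofReal (1 / (((q.1 : ℝ) + 1) * ((q.1 : ℝ) + q.2.1 + 2) * ((q.2.2 : ℝ) + 1) * ((q.1 : ℝ) + q.2.1 + q.2.2 + 3))))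
  rw [hV, hW, hX]
  ring

/-! ### Second evaluation: `V = 4 ζ(2,1,1) + 2 ζ(2,2) + 2 ζ(3,1)` -/

/-- Telescoping the innermost variable: for fixed `n, k`, with `M = n+k+2`,
`∑_{j ≥ 0} 1/((n+1)(k+1)(j+1)(j+1+M)) = H_M/((n+1)(k+1)M) = ∑_{i<M} 1/((n+1)(k+1)M(i+1))`
(`1/((j+1)(j+1+M)) = M⁻¹ ∑_{i<M} 1/((j+i+1)(j+i+2))` and `∑_j 1/((j+i+1)(j+i+2)) = 1/(i+1)`,
Borwein–Bradley 2006, §2). [cite: BorweinBradley2006, §2] -/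
theorem tsum_vAux_inner (n k : ℕ) :
    ∑' j : ℕ, ENNReal.ofReal (1 / (((n : ℝ) + 1) * ((k : ℝ) + 1) * ((j : ℝ) + 1) * ((n : ℝ) + k + j + 3))) =
      ∑ i ∈ Finset.range (n + k + 2),
        ENNReal.ofReal (1 / (((n : ℝ) + 1) * ((k : ℝ) + 1) * ((n : ℝ) + k + 2) * ((i : ℝ) + 1))) := by
  have hdec : ∀ j : ℕ, ENNReal.ofReal (1 / (((n : ℝ) + 1) * ((k : ℝ) + 1) * ((j : ℝ) + 1) * ((n : ℝ) + k + j + 3))) =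
      ∑ i ∈ Finset.range (n + k + 2), ENNReal.ofReal (1 / (((n : ℝ) + 1) * ((k : ℝ) + 1) * ((n : ℝ) + k + 2))) *
        ENNReal.ofReal (1 / (((j : ℝ) + i + 1) * ((j : ℝ) + i + 2))) := by
    intro j
    simp_rw [← ENNReal.ofReal_mul
      (show (0 : ℝ) ≤ 1 / (((n : ℝ) + 1) * ((k : ℝ) + 1) * ((n : ℝ) + k + 2)) by positivity)]
    rw [← ENNReal.ofReal_sum_of_nonneg (fun i _ => by positivity), ← Finset.mul_sum,
      sum_range_inv_mul_succ_eq' j (n + k + 2)]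
    congr 1
    push_cast
    field_simp
    ring
  simp_rw [hdec]
  rw [Summable.tsum_finsetSum (fun _ _ => ENNReal.summable)]
  simp_rw [ENNReal.tsum_mul_left, tsum_ofReal_inv_mul_succ_eq]
  refine Finset.sum_congr rfl fun i _ => ?_
  rw [← ENNReal.ofReal_mul (by positivity)]
  congr 1
  field_simp

/-- `V = U + U` in `ℝ≥0∞`, where `U = ∑_{n,k} ∑_{i < n+k+2} 1/((n+1)(n+k+2)²(i+1))`
(`= ∑_{m > a ≥ 1} H_m/(a m²)`): telescope the innermost variable (`tsum_vAux_inner`), split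
`1/((n+1)(k+1)(n+k+2)) = (1/(n+1) + 1/(k+1))/(n+k+2)²` and use the symmetry `n ↔ k`.
[folklore] -/
theorem tsum_vAux_eq_uAux_add :
    ∑' p : ℕ × ℕ × ℕ, ENNReal.ofReal (1 / (((p.1 : ℝ) + 1) * ((p.2.1 : ℝ) + 1) * ((p.2.2 : ℝ) + 1) * ((p.1 : ℝ) + p.2.1 + p.2.2 + 3))) =
      (∑' q : ℕ × ℕ, ∑ i ∈ Finset.range (q.1 + q.2 + 2), ENNReal.ofReal (1 / (((q.1 : ℝ) + 1) * ((q.1 : ℝ) + q.2 + 2) ^ 2 * ((i : ℝ) + 1)))) +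
        ∑' q : ℕ × ℕ, ∑ i ∈ Finset.range (q.1 + q.2 + 2), ENNReal.ofReal (1 / (((q.1 : ℝ) + 1) * ((q.1 : ℝ) + q.2 + 2) ^ 2 * ((i : ℝ) + 1))) := by
  have hg : ∀ n k i : ℕ,
      ENNReal.ofReal (1 / (((n : ℝ) + 1) * ((k : ℝ) + 1) * ((n : ℝ) + k + 2) * ((i : ℝ) + 1))) =
        ENNReal.ofReal (1 / (((n : ℝ) + 1) * ((n : ℝ) + k + 2) ^ 2 * ((i : ℝ) + 1))) +
          ENNReal.ofReal (1 / (((k : ℝ) + 1) * ((k : ℝ) + n + 2) ^ 2 * ((i : ℝ) + 1))) := by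
    intro n k i
    rw [← ENNReal.ofReal_add (by positivity) (by positivity)]
    congr 1
    field_simp
    ring
  rw [ENNReal.tsum_prod']
  simp_rw [ENNReal.tsum_prod', tsum_vAux_inner, hg, Finset.sum_add_distrib, ENNReal.tsum_add]
  refine congrArg₂ (· + ·) rfl ?_
  rw [ENNReal.tsum_comm]
  exact tsum_congr fun k => tsum_congr fun n => by rw [Nat.add_comm n k]

/-- Splitting `∑_{i < n+k+2}` at `i = n`: `i < n`, `i = n`, `i = n+1+u` (`u < k`), `i = n+k+1`.
[folklore] -/
theorem sum_range_add_two_split (h : ℕ → ℝ≥0∞) (n k : ℕ) :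
    ∑ i ∈ Finset.range (n + k + 2), h i =
      (∑ i ∈ Finset.range n, h i) + h n + (∑ u ∈ Finset.range k, h (n + 1 + u)) +
        h (n + k + 1) := by
  rw [Finset.sum_range_succ, show n + k + 1 = n + 1 + k by ring, Finset.sum_range_add,
    Finset.sum_range_succ]

/-- **`U = 2 ζ(2,1,1) + ζ(2,2) + ζ(3,1)`** in `ℝ≥0∞`: in `U = ∑_{m > a ≥ 1} ∑_{i ≤ m} 1/(i a m²)`
the ranges `i < a`, `i = a`, `a < i < m`, `i = m` contribute `ζ(2,1,1)`, `ζ(2,2)`, `ζ(2,1,1)`,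
`ζ(3,1)` respectively (all in product coordinates). [folklore] -/
theorem tsum_uAux_eq :
    ∑' q : ℕ × ℕ, ∑ i ∈ Finset.range (q.1 + q.2 + 2), ENNReal.ofReal (1 / (((q.1 : ℝ) + 1) * ((q.1 : ℝ) + q.2 + 2) ^ 2 * ((i : ℝ) + 1))) =
      (∑' p : ℕ × ℕ × ℕ, ENNReal.ofReal (1 / (((p.1 : ℝ) + 1) * ((p.1 : ℝ) + p.2.1 + 2) * ((p.1 : ℝ) + p.2.1 + p.2.2 + 3) ^ 2))) +
        (∑' p : ℕ × ℕ, ENNReal.ofReal (1 / (((p.1 : ℝ) + 1) ^ 2 * ((p.1 : ℝ) + p.2 + 2) ^ 2))) +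
        (∑' p : ℕ × ℕ × ℕ, ENNReal.ofReal (1 / (((p.1 : ℝ) + 1) * ((p.1 : ℝ) + p.2.1 + 2) * ((p.1 : ℝ) + p.2.1 + p.2.2 + 3) ^ 2))) +
        ∑' p : ℕ × ℕ, ENNReal.ofReal (1 / (((p.1 : ℝ) + 1) * ((p.1 : ℝ) + p.2 + 2) ^ 3)) := by
  have hZ : ∑' p : ℕ × ℕ × ℕ, ENNReal.ofReal (1 / (((p.1 : ℝ) + 1) * ((p.1 : ℝ) + p.2.1 + 2) * ((p.1 : ℝ) + p.2.1 + p.2.2 + 3) ^ 2)) =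
      ∑' a : ℕ, ∑' b : ℕ, ∑' c : ℕ, ENNReal.ofReal (1 / (((a : ℝ) + 1) * ((a : ℝ) + b + 2) * ((a : ℝ) + b + c + 3) ^ 2)) := by
    rw [ENNReal.tsum_prod']
    exact tsum_congr fun a => ENNReal.tsum_prod'
  have hsplit : ∀ q : ℕ × ℕ, ∑ i ∈ Finset.range (q.1 + q.2 + 2), ENNReal.ofReal (1 / (((q.1 : ℝ) + 1) * ((q.1 : ℝ) + q.2 + 2) ^ 2 * ((i : ℝ) + 1))) =
      (∑ i ∈ Finset.range q.1, ENNReal.ofReal (1 / (((q.1 : ℝ) + 1) * ((q.1 : ℝ) + q.2 + 2) ^ 2 * ((i : ℝ) + 1)))) +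
        ENNReal.ofReal (1 / (((q.1 : ℝ) + 1) * ((q.1 : ℝ) + q.2 + 2) ^ 2 * ((q.1 : ℝ) + 1))) +
        (∑ u ∈ Finset.range q.2, ENNReal.ofReal (1 / (((q.1 : ℝ) + 1) * ((q.1 : ℝ) + q.2 + 2) ^ 2 * (((q.1 + 1 + u : ℕ) : ℝ) + 1)))) +
        ENNReal.ofReal (1 / (((q.1 : ℝ) + 1) * ((q.1 : ℝ) + q.2 + 2) ^ 2 * (((q.1 + q.2 + 1 : ℕ) : ℝ) + 1))) := fun q =>
    sum_range_add_two_split (fun i => ENNReal.ofReal (1 / (((q.1 : ℝ) + 1) * ((q.1 : ℝ) + q.2 + 2) ^ 2 * ((i : ℝ) + 1)))) q.1 q.2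
  simp_rw [hsplit]
  rw [ENNReal.tsum_add, ENNReal.tsum_add, ENNReal.tsum_add]
  have hA : ∑' q : ℕ × ℕ, ∑ i ∈ Finset.range q.1, ENNReal.ofReal (1 / (((q.1 : ℝ) + 1) * ((q.1 : ℝ) + q.2 + 2) ^ 2 * ((i : ℝ) + 1))) =
      ∑' p : ℕ × ℕ × ℕ, ENNReal.ofReal (1 / (((p.1 : ℝ) + 1) * ((p.1 : ℝ) + p.2.1 + 2) * ((p.1 : ℝ) + p.2.1 + p.2.2 + 3) ^ 2)) := by
    have h1 : ∀ n : ℕ, ∑' k : ℕ, ∑ i ∈ Finset.range n, ENNReal.ofReal (1 / (((n : ℝ) + 1) * ((n : ℝ) + k + 2) ^ 2 * ((i : ℝ) + 1))) =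
        ∑ i ∈ Finset.range n, ∑' k : ℕ, ENNReal.ofReal (1 / (((n : ℝ) + 1) * ((n : ℝ) + k + 2) ^ 2 * ((i : ℝ) + 1))) := fun n =>
      Summable.tsum_finsetSum (fun _ _ => ENNReal.summable)
    rw [hZ, ENNReal.tsum_prod']
    simp_rw [h1]
    rw [ennreal_tsum_sum_range_eq_tsum_prod
      (fun i n => ∑' k : ℕ, ENNReal.ofReal (1 / (((n : ℝ) + 1) * ((n : ℝ) + k + 2) ^ 2 * ((i : ℝ) + 1)))), ENNReal.tsum_prod']
    refine tsum_congr fun i => tsum_congr fun t => tsum_congr fun k => ?_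
    congr 1
    push_cast
    ring
  have hB : ∑' q : ℕ × ℕ, ENNReal.ofReal (1 / (((q.1 : ℝ) + 1) * ((q.1 : ℝ) + q.2 + 2) ^ 2 * ((q.1 : ℝ) + 1))) =
      ∑' p : ℕ × ℕ, ENNReal.ofReal (1 / (((p.1 : ℝ) + 1) ^ 2 * ((p.1 : ℝ) + p.2 + 2) ^ 2)) :=
    tsum_congr fun q => by congr 1; ring
  have hC : ∑' q : ℕ × ℕ, ∑ u ∈ Finset.range q.2, ENNReal.ofReal (1 / (((q.1 : ℝ) + 1) * ((q.1 : ℝ) + q.2 + 2) ^ 2 * (((q.1 + 1 + u : ℕ) : ℝ) + 1))) =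
      ∑' p : ℕ × ℕ × ℕ, ENNReal.ofReal (1 / (((p.1 : ℝ) + 1) * ((p.1 : ℝ) + p.2.1 + 2) * ((p.1 : ℝ) + p.2.1 + p.2.2 + 3) ^ 2)) := by
    rw [hZ, ENNReal.tsum_prod']
    refine tsum_congr fun n => ?_
    rw [ennreal_tsum_sum_range_eq_tsum_prod
      (fun u k => ENNReal.ofReal (1 / (((n : ℝ) + 1) * ((n : ℝ) + k + 2) ^ 2 * (((n + 1 + u : ℕ) : ℝ) + 1)))), ENNReal.tsum_prod']
    refine tsum_congr fun u => tsum_congr fun v => ?_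
    congr 1
    push_cast
    ring
  have hD : ∑' q : ℕ × ℕ, ENNReal.ofReal (1 / (((q.1 : ℝ) + 1) * ((q.1 : ℝ) + q.2 + 2) ^ 2 * (((q.1 + q.2 + 1 : ℕ) : ℝ) + 1))) =
      ∑' p : ℕ × ℕ, ENNReal.ofReal (1 / (((p.1 : ℝ) + 1) * ((p.1 : ℝ) + p.2 + 2) ^ 3)) :=
    tsum_congr fun q => by congr 1; push_cast; ring
  rw [hA, hB, hC, hD]

/-! ### Hoffman's relation and the duality `ζ(2,1,1) = ζ(4)` -/

/-- Hoffman's relation in `ℝ≥0∞`: `Z₂₁₁ = Z₂₂ + Z₃₁` for the `ofReal`s of `ζ(2,1,1)`, `ζ(2,2)`,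
`ζ(3,1)`: compare `V = 6 Z₂₁₁` with `V = U + U = 4 Z₂₁₁ + 2 Z₂₂ + 2 Z₃₁` and cancel the finite
quantity `4 Z₂₁₁`. [cite: Hoffman1992, Theorem 5.1] -/
theorem ofReal_multipleZeta_two_one_one_eq_add :
    ENNReal.ofReal (multipleZeta [2, 1, 1]) =
      ENNReal.ofReal (multipleZeta [2, 2]) + ENNReal.ofReal (multipleZeta [3, 1]) := by
  have hfin : ENNReal.ofReal (multipleZeta [2, 1, 1]) ≠ ∞ := ENNReal.ofReal_ne_top
  have h1 := tsum_vAux_eq_six_mul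
  have h2 := tsum_vAux_eq_uAux_add
  have h3 := tsum_uAux_eq
  rw [ofReal_multipleZeta_two_one_one] at hfin
  rw [ofReal_multipleZeta_two_one_one, ofReal_multipleZeta_two_two,
    ofReal_multipleZeta_three_one]
  set Z := ∑' p : ℕ × ℕ × ℕ, ENNReal.ofReal (1 / (((p.1 : ℝ) + 1) * ((p.1 : ℝ) + p.2.1 + 2) * ((p.1 : ℝ) + p.2.1 + p.2.2 + 3) ^ 2))
  set Z22 := ∑' p : ℕ × ℕ, ENNReal.ofReal (1 / (((p.1 : ℝ) + 1) ^ 2 * ((p.1 : ℝ) + p.2 + 2) ^ 2))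
  set Z31 := ∑' p : ℕ × ℕ, ENNReal.ofReal (1 / (((p.1 : ℝ) + 1) * ((p.1 : ℝ) + p.2 + 2) ^ 3))
  set U := ∑' q : ℕ × ℕ, ∑ i ∈ Finset.range (q.1 + q.2 + 2), ENNReal.ofReal (1 / (((q.1 : ℝ) + 1) * ((q.1 : ℝ) + q.2 + 2) ^ 2 * ((i : ℝ) + 1)))
  set V := ∑' p : ℕ × ℕ × ℕ, ENNReal.ofReal (1 / (((p.1 : ℝ) + 1) * ((p.2.1 : ℝ) + 1) * ((p.2.2 : ℝ) + 1) * ((p.1 : ℝ) + p.2.1 + p.2.2 + 3)))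
  have h4 : 4 * Z ≠ ∞ := ENNReal.mul_ne_top (by simp) hfin
  have h : 4 * Z + 2 * Z = 4 * Z + 2 * (Z22 + Z31) := by
    calc 4 * Z + 2 * Z = 6 * Z := by ring
      _ = V := h1.symm
      _ = U + U := h2
      _ = 4 * Z + 2 * (Z22 + Z31) := by rw [h3]; ring
  exact (ENNReal.mul_right_inj two_ne_zero ENNReal.ofNat_ne_top).mp
    ((ENNReal.add_right_inj h4).mp h)

/-- **Hoffman's relation in weight `4`**: `ζ(2,1,1) = ζ(3,1) + ζ(2,2)` (Hoffman 1992,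
Theorem 5.1 — `∑_l A(…, i_l + 1, …) = ∑_{l : i_l ≥ 2} ∑_{j=0}^{i_l-2} A(…, i_l - j, j+1, …)` —
for the sequence `(i₁, i₂) = (2, 1)`: `A(3,1) + A(2,2) = A(2,1,1)`).
[cite: Hoffman1992, Theorem 5.1] -/
theorem multipleZeta_two_one_one_eq_add :
    multipleZeta [2, 1, 1] = multipleZeta [3, 1] + multipleZeta [2, 2] := by
  have h211 := (multipleZeta_pos_of_isAdmissible_holds
    (MZV.isAdmissible_triple le_rfl le_rfl le_rfl : MZV.IsAdmissible [2, 1, 1])).le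
  have h31 := (multipleZeta_pos_of_isAdmissible_holds
    (MZV.isAdmissible_pair (by norm_num : 2 ≤ 3) le_rfl)).le
  have h22 := (multipleZeta_pos_of_isAdmissible_holds
    (MZV.isAdmissible_pair le_rfl one_le_two)).le
  have h := ofReal_multipleZeta_two_one_one_eq_add
  rw [← ENNReal.ofReal_add h22 h31, ENNReal.ofReal_eq_ofReal_iff h211 (add_nonneg h22 h31)] at h
  rw [h, add_comm]

/-- **Duality in weight `4`**: `ζ(2,1,1) = ζ(4)` (Hoffman 1992, Theorem 4.4,
`A(h+1,1,…,1) = A(k+1,1,…,1)` with `h = 1`, `k = 3`; Chmutov–Duzhin–Mostovoy 2012, §10.2.6,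
duality table, `ζ(1,1,2) = ζ(4)` in the increasing convention). Here: Hoffman's relation plus
Euler's sum formula `ζ(3,1) + ζ(2,2) = ζ(4)`. [cite: Hoffman1992, Theorem 4.4] -/
theorem multipleZeta_two_one_one_eq_four : multipleZeta [2, 1, 1] = multipleZeta [4] := by
  rw [multipleZeta_two_one_one_eq_add, multipleZeta_three_one_add_two_two]

/-- `ζ(2,1,1) = π⁴ / 90` (Chmutov–Duzhin–Mostovoy 2012, §10.2.6: `ζ(1,1,2) = ζ(4) = π⁴/90` in the
increasing convention). [cite: ChmutovDuzhinMostovoy2012, §10.2.6] -/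
theorem multipleZeta_two_one_one : multipleZeta [2, 1, 1] = Real.pi ^ 4 / 90 := by
  rw [multipleZeta_two_one_one_eq_four, multipleZeta_four]

end Literature.NumberTheory.Transcendental
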